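import Summits.Ventures.Crystal3D.Bulk.LocalTwelve
import Summits.Ventures.Crystal3D.StickySpheres.ContactGraphFilters
import HarnessLib

/-!
# At most one twelve-coordinated ball among `N ≤ 18`; the constant floor `K ≥ 17/18^{2/3} ≈ 2.475`
# for `BulkCrystallization3D K`

HONEST FRAMING. Part of the venture `Summits/Ventures/Crystal3D` (cell `pub-crystal3d`, phase 2;
sub-cell `crystal3d-paper`, HUMAN RULING D-0044; lead RULING #234 (4) «P7 — constant floor»; seat
p2 g18). A sharpness-side remark on the CONSTANT of `BulkCrystallization3D K`, one step beyond the
`N = 12` floor `12^{1/3} ≈ 2.289` of `Bulk/BulkConstantFloor.lean` (not imported: that module has no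
hub build yet; nothing here restates it). It asserts NOTHING about whether `BulkCrystallization3D K`
holds for any `K`, says nothing about large `N`, and moves no count / head / class / grade word.

The remark: in ANY packing of `N ≤ 18` unit balls AT MOST ONE ball has twelve contacts — two
twelve-coordinated balls `i ≠ j` would have at least `11 + 11 − (N − 2) = 24 − N ≥ 6` common contact
neighbours, while any two distinct balls of a packing have at most five
(`card_common_contactNeighbors_le_five'`, `StickySpheres/ContactGraphFilters.lean`: the common
neighbours lie on a circle of radius `≤ √3/2` at mutual distance `≥ 1`). Hence every sticky ground
state of `N ≤ 18` balls has `≥ N − 1` defects, `BulkCrystallization3D K` gives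
`N − 1 ≤ K · N^{2/3}` for every `N ≤ 18`, and at `N = 18`: `K ≥ 17/18^{2/3} = 2.4751…`.
(`17/18^{2/3}` is the best this trivial count gives: `(N−1)/N^{2/3}` increases with `N` and the
common-neighbour count stops excluding a second twelve-coordinated ball at `N = 19`.)
Closure: standard axioms.

Contents: `card_filter_coordination_eq_twelve_le_one` (the one-ball lemma),
`pred_le_card_nonClosePacked` (`N − 1 ≤ #nonClosePacked` for `N ≤ 18`),
`pred_le_of_bulkCrystallization3D` (`N − 1 ≤ K·N^{2/3}`, `N ≤ 18`),
`not_bulkCrystallization3D_of_le_2474` (`K ≤ 2.474` fails, from `N = 18`).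
-/

noncomputable section

open Finset

namespace Summit.Ventures.Crystal3D

open Literature.Geometry.DiscreteGeometry

variable {N : ℕ}

/-- **Among `N ≤ 18` packed unit balls at most one has twelve contacts.** Two twelve-coordinated
balls `i ≠ j` would share `≥ 24 − N ≥ 6` contact neighbours; a packing allows at most five
(`card_common_contactNeighbors_le_five'`). [folklore] -/
theorem card_filter_coordination_eq_twelve_le_one (hN : N ≤ 18) {x : Fin N → EuclideanSpace ℝ (Fin 3)}
    (hx : IsUnitPacking x) : (univ.filter fun i => coordination x i = 12).card ≤ 1 := by
  classical
  rw [Finset.card_le_one]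
  intro i hi j hj
  by_contra hij
  rw [mem_filter] at hi hj
  have h5 := card_common_contactNeighbors_le_five' hx hij
  -- the two neighbourhoods, minus `{i, j}`, live in `univ \ {i, j}` of size `N − 2`
  set A := contactNeighbors x i with hA
  set B := contactNeighbors x j with hB
  have hAc : A.card = 12 := hi.2
  have hBc : B.card = 12 := hj.2
  have hiA : i ∉ A := by rw [hA, mem_contactNeighbors]; exact fun h => h.1 rfl
  have hjB : j ∉ B := by rw [hB, mem_contactNeighbors]; exact fun h => h.1 rfl
  -- `A.erase j` and `B.erase i` are subsets of `univ.erase i |>.erase j`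
  set U := (univ.erase i).erase j with hU
  have hUc : U.card = N - 2 := by
    rw [hU, card_erase_of_mem, card_erase_of_mem (mem_univ i), card_univ, Fintype.card_fin]
    · omega
    · exact mem_erase.2 ⟨fun h => hij (h.symm), mem_univ j⟩
  have hAU : A.erase j ⊆ U := by
    intro k hk
    rw [mem_erase] at hk
    have hki : k ≠ i := fun h => hiA (h ▸ hk.2)
    exact mem_erase.2 ⟨hk.1, mem_erase.2 ⟨hki, mem_univ k⟩⟩
  have hBU : B.erase i ⊆ U := by
    intro k hk
    rw [mem_erase] at hk
    have hkj : k ≠ j := fun h => hjB (h ▸ hk.2)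
    exact mem_erase.2 ⟨hkj, mem_erase.2 ⟨hk.1, mem_univ k⟩⟩
  have hAe : 11 ≤ (A.erase j).card := by
    have := Finset.pred_card_le_card_erase (s := A) (a := j); omega
  have hBe : 11 ≤ (B.erase i).card := by
    have := Finset.pred_card_le_card_erase (s := B) (a := i); omega
  -- inclusion–exclusion inside `U`
  have hunion : ((A.erase j) ∪ (B.erase i)).card ≤ U.card := card_le_card (union_subset hAU hBU)
  have hie := Finset.card_union_add_card_inter (A.erase j) (B.erase i)
  have hsub : (A.erase j) ∩ (B.erase i) ⊆ A ∩ B :=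
    inter_subset_inter (erase_subset _ _) (erase_subset _ _)
  have hinter := card_le_card hsub
  omega

/-- **A packing of `N ≤ 18` balls has at least `N − 1` defects**: every ball other than (at most)
one twelve-coordinated ball is in `nonClosePacked x`. [folklore] -/
theorem pred_le_card_nonClosePacked (hN : N ≤ 18) {x : Fin N → EuclideanSpace ℝ (Fin 3)}
    (hx : IsUnitPacking x) : N - 1 ≤ (nonClosePacked x).card := by
  classical
  have h1 := card_filter_coordination_eq_twelve_le_one hN hx
  -- complement of `nonClosePacked` is inside the twelve-coordinated balls
  have hsub : univ \ nonClosePacked x ⊆ univ.filter fun i => coordination x i = 12 := by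
    intro i hi
    rw [mem_sdiff, mem_nonClosePacked, not_not] at hi
    exact mem_filter.2 ⟨mem_univ i, hi.2.coordination_eq hx⟩
  have h2 : (univ \ nonClosePacked x).card ≤ 1 := (card_le_card hsub).trans h1
  have h3 : (univ \ nonClosePacked x).card = N - (nonClosePacked x).card := by
    rw [card_sdiff_of_subset (subset_univ _), card_univ, Fintype.card_fin]
  have h4 : (nonClosePacked x).card ≤ N := by
    calc (nonClosePacked x).card ≤ (univ : Finset (Fin N)).card := card_le_card (subset_univ _)
      _ = N := by rw [card_univ, Fintype.card_fin]
  omega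

/-- **`BulkCrystallization3D K` forces `N − 1 ≤ K · N^{2/3}` for every `N ≤ 18`** (at a sticky
ground state of `N` balls, which exists by `exists_numContacts_eq_maxContacts`). -/
theorem pred_le_of_bulkCrystallization3D {K : ℝ} (hB : BulkCrystallization3D K) (hN : N ≤ 18) :
    ((N : ℝ) - 1) ≤ K * (N : ℝ) ^ ((2 : ℝ) / 3) := by
  classical
  obtain ⟨x, hx, hxe⟩ := exists_numContacts_eq_maxContacts (d := 3) (N := N) (by norm_num)
  have hgs : IsStickyGroundState x := by
    unfold IsStickyGroundState
    exact ⟨hx, hxe⟩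
  have h1 := hB N x hgs
  have h2 := pred_le_card_nonClosePacked hN hx
  have h3 : ((N : ℝ) - 1) ≤ ((nonClosePacked x).card : ℝ) := by
    have h2' : ((N - 1 : ℕ) : ℝ) ≤ ((nonClosePacked x).card : ℝ) := by exact_mod_cast h2
    rcases Nat.eq_zero_or_pos N with h0 | hpos
    · subst h0; simp
    · rw [Nat.cast_sub hpos, Nat.cast_one] at h2'
      exact h2'
  exact h3.trans h1

/-- **`BulkCrystallization3D K` is false for every `K ≤ 2.474`** (`N = 18`: `17 ≤ K · 18^{2/3}`,
and `2.474 · 18^{2/3} < 17` since `(2.474)³ · 18² = 324·15.14… < 17³ = 4913` — precisely,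
`18^{2/3} < 17/2.474` because `18² = 324 < (17/2.474)³ = 324.45…`). Sharpens `K ≥ 12^{1/3} ≈ 2.289`
(`Bulk/BulkConstantFloor.lean`) to `K > 2.474`; still says nothing about large `N`. -/
theorem not_bulkCrystallization3D_of_le_2474 {K : ℝ} (hK : K ≤ 2.474) : ¬ BulkCrystallization3D K := by
  intro hB
  have h := pred_le_of_bulkCrystallization3D (N := 18) hB le_rfl
  push_cast at h
  -- `18^{2/3} < 17/2.474`: compare cubes
  have hpow : ((18 : ℝ) ^ ((2 : ℝ) / 3)) ^ (3 : ℕ) = 18 ^ 2 := by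
    rw [← Real.rpow_natCast, ← Real.rpow_mul (by norm_num)]
    norm_num
  have hpos : (0 : ℝ) < (18 : ℝ) ^ ((2 : ℝ) / 3) := by positivity
  have hlt : (18 : ℝ) ^ ((2 : ℝ) / 3) < 6.8714 := by
    by_contra hle
    push Not at hle
    have h3 : (6.8714 : ℝ) ^ (3 : ℕ) ≤ ((18 : ℝ) ^ ((2 : ℝ) / 3)) ^ (3 : ℕ) :=
      pow_le_pow_left₀ (by norm_num) hle 3
    rw [hpow] at h3
    norm_num at h3
  nlinarith

end Summit.Ventures.Crystal3D

end
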